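/-
b2b-lace packet, LITERATURE seat gen 18 (unit `b2b-lace-lit-g18`).  (S2b)-IMPR-L3 (S1a–d), module 3 of 3: the CLOSED window
`c₀ = 1 − F̂_z(0) ≥ 0` (tail-g9's spec `NobleH1StepSpec.lean` states the four x-space bounds with the non-strict `F̂_z(0) ≤ 1`; modules 1–2
proved them on the open window `F̂_z(0) < 1`).  NEW additive module; nothing existing is touched; no named fact; d-generic, no numeral.
-/
import Literature.Probability.FitznerVanDerHofstad2017.NobleH1XSpace
import HarnessLib

/-!
# Literature.Probability.FitznerVanDerHofstad2017.NobleH1XSpaceBoundary — Step 1 of [NoBLE17] §3.3.5 on the closed window `F̂_z(0) ≤ 1`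

[NoBLE17] = R. Fitzner, R. van der Hofstad, *Generalized approach to the non-backtracking lace expansion*, PTRF 169 (2017) 1041–1119;
[Fit13] = R. Fitzner, PhD thesis (TU/e 2013), §3.6.

`SrwIntegralMassive` / `NobleH1XSpace` prove the four one-sided x-space bounds of Step 1 ((3.59)–(3.60), the slots
`X_{q,l}(x) = ∫ Ĉ*^q M̂* D̂^l D̂^{(x)} dk/(2π)^d`, `q = m + 2` and `q = 1`) on the OPEN window `c₀ := 1 − F̂_z(0) = 1 − (c_F + α_F + R̂_F(0)) > 0`,
where `Ĉ* = a Ĉ_μ` with `0 ≤ μ = α_F a < 1` is a genuinely massive resolvent.  This module closes the boundary `c₀ = 0` (the massless case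
`Ĉ* = Ĉ/α_F` of [Fit13] (3.6.55)), i.e. proves the same four statements under the NON-STRICT hypothesis `c_F + α_F + R̂_F(0) ≤ 1` — exactly the
binder list of tail-g9's spec — by continuity in the mass:

* the integrand `Ĉ*^q M̂* D̂^l D̂^{(x)}` depends on `c_F` only through `Ĉ*(k) = 1/(c₀ + α_F[1 − D̂(k)])`; replacing `c_F` by `c_F − 1/(n+1)` puts the
  parameters on the open window (`c₀ + 1/(n+1) > 0`) where modules 1–2 apply, with the SAME right-hand sides (they do not involve `c_F`);
* off the null set `{D̂ = 1}` (`ae_abs_Dhat_lt_one`) the perturbed integrand converges pointwise as `n → ∞` and is dominated, uniformly in `n`, by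
  `5 · |D̂|^l |D̂^{(x)}| Ĉ^q` (`0 < Ĉ* ≤ Ĉ = 1/[1 − D̂]` for `α_F ≥ 1`, `|M̂*| ≤ |D̂| + 2 D̂^{sin} Ĉ* ≤ 1 + 4/d ≤ 5` from `D̂^{sin} ≤ (2/d)[1 − D̂]`),
  which is integrable for `d ≥ 2q + 1` (`integrable_srwK_integrand`, Heydenreich–van der Hofstad Prop. 5.5);
* dominated convergence (`tendsto_integral_of_dominated_convergence`) and `le_of_tendsto'` / `ge_of_tendsto'`.

Main results (namespace `Literature.Probability.FitznerVanDerHofstad2017`, binders VERBATIM those of the spec):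
`integral_Cstar_pow_Mstar_le_of_le` (S1a), `neg_le_integral_Cstar_pow_Mstar_of_le` (S1b), `integral_Cstar_Mstar_le_of_le` (S1c),
`neg_le_integral_Cstar_Mstar_of_le` (S1d); and `integrable_stepOne_integrand` (the slot integrand is integrable for `d ≥ 2q+1`).
[cite: FitznerVanDerHofstad2016NoBLE, §3.3.4 (3.40)–(3.45) p. 1072 and §3.3.5 Step 1 (3.59)–(3.61) pp. 1074–1075; Fitzner2013Thesis, §3.6.4 (3.6.53)–(3.6.56) p. 107;
HeydenreichVanDerHofstad2017, Prop. 5.5]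
-/

open MeasureTheory Real Finset Filter Topology
open scoped BigOperators

namespace Literature.Probability.FitznerVanDerHofstad2017

open Literature.Barriers.CriticalPhenomena
open Literature.Barriers.CriticalPhenomena.Slade2006Prop53 (P)
open Literature.Probability.LatticeModels

variable {d : ℕ}

section Boundary

variable {cΦ αΦ cF αF : ℝ} {RΦ RF : Site d → ℝ}

/-- Closed form `Ĉ*(k) = 1/(c₀ + α_F[1 − D̂(k)])`, `c₀ = 1 − (c_F + α_F + R̂_F(0))`. [cite: FitznerVanDerHofstad2016NoBLE, (3.40)–(3.41) p. 1072] -/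
theorem lapAtomsAt_Cstar_eq_one_div (k : Fin d → ℝ) :
    (lapAtomsAt d cΦ αΦ cF αF RΦ RF k).Cstar = 1 / ((1 - (cF + αF + cosFT RF 0)) + αF * (1 - Dhat d k)) := by
  rw [LapAtoms.Cstar, lapAtomsAt_Cden_eq]

/-- On the closed window with `α_F ≥ 1`, off `{D̂ = 1}`: `0 < Ĉ*(k) ≤ Ĉ(k) = 1/[1 − D̂(k)]`.
[cite: FitznerVanDerHofstad2016NoBLE, (3.40) and (3.43) p. 1072 (Ĉ* ≤ α_F⁻¹ Ĉ, the sentence after (3.40))] -/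
theorem Cstar_pos_and_le_Chat_one (hc0 : cF + αF + cosFT RF 0 ≤ 1) (hα : 1 ≤ αF) {k : Fin d → ℝ}
    (hk : Dhat d k < 1) :
    0 < (lapAtomsAt d cΦ αΦ cF αF RΦ RF k).Cstar ∧ (lapAtomsAt d cΦ αΦ cF αF RΦ RF k).Cstar ≤ Chat d 1 k := by
  rw [lapAtomsAt_Cstar_eq_one_div, Chat, one_mul]
  have h1 : 0 < 1 - Dhat d k := sub_pos.2 hk
  have h2 : 1 - Dhat d k ≤ (1 - (cF + αF + cosFT RF 0)) + αF * (1 - Dhat d k) := by nlinarith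
  exact ⟨one_div_pos.2 (lt_of_lt_of_le h1 h2), one_div_le_one_div_of_le h1 h2⟩

/-- On the closed window with `α_F ≥ 1`, off `{D̂ = 1}`: `|M̂*(k)| ≤ |D̂| + 2 D̂^{sin} Ĉ* ≤ 5` (coarse form of (3.45)).
[cite: FitznerVanDerHofstad2016NoBLE, (3.45) p. 1072] -/
theorem abs_Mstar_le_five (hd : 1 ≤ d) (hc0 : cF + αF + cosFT RF 0 ≤ 1) (hα : 1 ≤ αF) {k : Fin d → ℝ}
    (hk : Dhat d k < 1) : |(lapAtomsAt d cΦ αΦ cF αF RΦ RF k).Mstar| ≤ 5 := by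
  obtain ⟨hC0, hCle⟩ := Cstar_pos_and_le_Chat_one (cΦ := cΦ) (αΦ := αΦ) (RΦ := RΦ) hc0 hα hk
  have h1 : 0 < 1 - Dhat d k := sub_pos.2 hk
  have hd' : (1 : ℝ) ≤ d := by exact_mod_cast hd
  have hDs : Dsin d k * Chat d 1 k ≤ 2 := by
    rw [Chat, one_mul]
    calc Dsin d k * (1 / (1 - Dhat d k)) ≤ 2 / d * (1 - Dhat d k) * (1 / (1 - Dhat d k)) :=
          mul_le_mul_of_nonneg_right (Dsin_le hd k) (one_div_pos.2 h1).le
      _ = 2 / d := by field_simp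
      _ ≤ 2 := div_le_self (by norm_num) hd'
  have hDsC : Dsin d k * (lapAtomsAt d cΦ αΦ cF αF RΦ RF k).Cstar ≤ 2 :=
    (mul_le_mul_of_nonneg_left hCle (Dsin_nonneg k)).trans hDs
  have hD := abs_Dhat_le_one k
  rw [lapAtomsAt_Mstar_eq]
  calc |Dhat d k - 2 * Dsin d k * (lapAtomsAt d cΦ αΦ cF αF RΦ RF k).Cstar|
      ≤ |Dhat d k| + |2 * Dsin d k * (lapAtomsAt d cΦ αΦ cF αF RΦ RF k).Cstar| := abs_sub _ _
    _ ≤ 1 + 4 := by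
        refine add_le_add hD ?_
        rw [abs_of_nonneg (by have := Dsin_nonneg k; positivity)]
        linarith
    _ = 5 := by norm_num

/-- Uniform domination of the Step-1 integrand on the closed window: `|Ĉ*^q M̂* D̂^l D̂^{(x)}| ≤ 5 |D̂|^l |D̂^{(x)}| Ĉ^q` off `{D̂ = 1}`.
[cite: FitznerVanDerHofstad2016NoBLE, (3.40), (3.43), (3.45) p. 1072] -/
theorem abs_stepOne_integrand_le (hd : 1 ≤ d) (hc0 : cF + αF + cosFT RF 0 ≤ 1) (hα : 1 ≤ αF) (q l : ℕ)
    (x : Fin d → ℤ) {k : Fin d → ℝ} (hk : Dhat d k < 1) :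
    |(lapAtomsAt d cΦ αΦ cF αF RΦ RF k).Cstar ^ q * (lapAtomsAt d cΦ αΦ cF αF RΦ RF k).Mstar *
        (Dhat d k ^ l * DhatSym d x k)| ≤ 5 * ((|Dhat d k| ^ l * |DhatSym d x k|) * Chat d 1 k ^ q) := by
  obtain ⟨hC0, hCle⟩ := Cstar_pos_and_le_Chat_one (cΦ := cΦ) (αΦ := αΦ) (RΦ := RΦ) hc0 hα hk
  have hM := abs_Mstar_le_five (cΦ := cΦ) (αΦ := αΦ) (RΦ := RΦ) hd hc0 hα hk
  have hCq : (lapAtomsAt d cΦ αΦ cF αF RΦ RF k).Cstar ^ q ≤ Chat d 1 k ^ q := pow_le_pow_left₀ hC0.le hCle q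
  have hw : 0 ≤ |Dhat d k| ^ l * |DhatSym d x k| := by positivity
  have hCq0 : 0 ≤ Chat d 1 k ^ q := pow_nonneg (hC0.le.trans hCle) q
  rw [abs_mul, abs_mul, abs_pow, abs_mul, abs_pow, abs_of_pos hC0]
  calc (lapAtomsAt d cΦ αΦ cF αF RΦ RF k).Cstar ^ q * |(lapAtomsAt d cΦ αΦ cF αF RΦ RF k).Mstar| *
        (|Dhat d k| ^ l * |DhatSym d x k|)
      ≤ Chat d 1 k ^ q * 5 * (|Dhat d k| ^ l * |DhatSym d x k|) :=
        mul_le_mul_of_nonneg_right (mul_le_mul hCq hM (abs_nonneg _) hCq0) hw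
    _ = 5 * ((|Dhat d k| ^ l * |DhatSym d x k|) * Chat d 1 k ^ q) := by ring

/-- The Step-1 integrand `k ↦ Ĉ*^q M̂* D̂^l D̂^{(x)}` is measurable (a rational function of `D̂`, `D̂^{sin}`, `D̂^{(x)}`). [folklore] -/
theorem measurable_stepOne_integrand (q l : ℕ) (x : Fin d → ℤ) :
    Measurable fun k => (lapAtomsAt d cΦ αΦ cF αF RΦ RF k).Cstar ^ q * (lapAtomsAt d cΦ αΦ cF αF RΦ RF k).Mstar *
      (Dhat d k ^ l * DhatSym d x k) := by
  have hD := (continuous_Dhat d).measurable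
  have hS := (continuous_Dsin d).measurable
  have hX := measurable_DhatSym d x
  have hC : Measurable fun k => (lapAtomsAt d cΦ αΦ cF αF RΦ RF k).Cstar := by
    have e : (fun k => (lapAtomsAt d cΦ αΦ cF αF RΦ RF k).Cstar)
        = fun k => 1 / ((1 - (cF + αF + cosFT RF 0)) + αF * (1 - Dhat d k)) :=
      funext fun k => lapAtomsAt_Cstar_eq_one_div k
    rw [e]
    fun_prop
  have hM : Measurable fun k => (lapAtomsAt d cΦ αΦ cF αF RΦ RF k).Mstar := by
    simp only [lapAtomsAt_Mstar_eq]
    fun_prop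
  fun_prop

/-- **The Step-1 slot integrand is integrable** on the closed window for `d ≥ 2q + 1` (majorant `5|D̂|^l|D̂^{(x)}|Ĉ^q`) — the integrability
the linearity step `∫ Ĥ₁ D̂^l D̂^{(x)} = α_F c_Φ X_{2,l} + α_F α_Φ X_{2,l+1} + α_Φ X_{1,l}` of (3.59)–(3.61) needs.
[cite: FitznerVanDerHofstad2016NoBLE, §3.3.5 Step 1 (3.59)–(3.61) pp. 1074–1075; HeydenreichVanDerHofstad2017, Prop. 5.5] -/
theorem integrable_stepOne_integrand {q : ℕ} (hd : 2 * q + 1 ≤ d) (hc0 : cF + αF + cosFT RF 0 ≤ 1) (hα : 1 ≤ αF)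
    (l : ℕ) (x : Fin d → ℤ) :
    Integrable (fun k => (lapAtomsAt d cΦ αΦ cF αF RΦ RF k).Cstar ^ q * (lapAtomsAt d cΦ αΦ cF αF RΦ RF k).Mstar *
      (Dhat d k ^ l * DhatSym d x k)) (P d) := by
  have hd1 : 1 ≤ d := by omega
  refine ((integrable_srwK_integrand hd l x).const_mul 5).mono' (measurable_stepOne_integrand q l x).aestronglyMeasurable ?_
  filter_upwards [ae_abs_Dhat_lt_one (d := d) hd1] with k hk
  rw [Real.norm_eq_abs]
  exact abs_stepOne_integrand_le hd1 hc0 hα q l x (abs_lt.1 hk).2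

/-- Shifting `c_F` down by `1/(n+1)` moves the closed window into the open one. [folklore] -/
theorem perturb_lt_one (hc0 : cF + αF + cosFT RF 0 ≤ 1) (n : ℕ) :
    cF - 1 / ((n : ℝ) + 1) + αF + cosFT RF 0 < 1 := by
  have : 0 < 1 / ((n : ℝ) + 1) := by positivity
  linarith

/-- Pointwise continuity in the mass off `{D̂ = 1}`: the Step-1 integrand at `c_F − 1/(n+1)` converges to the one at `c_F`.
[cite: FitznerVanDerHofstad2016NoBLE, (3.40)–(3.45) p. 1072] -/
theorem tendsto_stepOne_integrand (hc0 : cF + αF + cosFT RF 0 ≤ 1) (hα : 1 ≤ αF) (q l : ℕ) (x : Fin d → ℤ)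
    {k : Fin d → ℝ} (hk : Dhat d k < 1) :
    Tendsto (fun n : ℕ => (lapAtomsAt d cΦ αΦ (cF - 1 / ((n : ℝ) + 1)) αF RΦ RF k).Cstar ^ q *
        (lapAtomsAt d cΦ αΦ (cF - 1 / ((n : ℝ) + 1)) αF RΦ RF k).Mstar * (Dhat d k ^ l * DhatSym d x k)) atTop
      (𝓝 ((lapAtomsAt d cΦ αΦ cF αF RΦ RF k).Cstar ^ q * (lapAtomsAt d cΦ αΦ cF αF RΦ RF k).Mstar *
        (Dhat d k ^ l * DhatSym d x k))) := by
  have h1 : 0 < 1 - Dhat d k := sub_pos.2 hk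
  have hKpos : 0 < (1 - (cF + αF + cosFT RF 0)) + αF * (1 - Dhat d k) := by nlinarith
  have hC : Tendsto (fun n : ℕ => (lapAtomsAt d cΦ αΦ (cF - 1 / ((n : ℝ) + 1)) αF RΦ RF k).Cstar) atTop
      (𝓝 (lapAtomsAt d cΦ αΦ cF αF RΦ RF k).Cstar) := by
    have e : (fun n : ℕ => (lapAtomsAt d cΦ αΦ (cF - 1 / ((n : ℝ) + 1)) αF RΦ RF k).Cstar)
        = fun n : ℕ => 1 / (((1 - (cF + αF + cosFT RF 0)) + αF * (1 - Dhat d k)) + 1 / ((n : ℝ) + 1)) := by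
      funext n
      rw [lapAtomsAt_Cstar_eq_one_div]
      congr 1
      ring
    rw [e, lapAtomsAt_Cstar_eq_one_div]
    have h := (tendsto_const_nhds (x := (1 - (cF + αF + cosFT RF 0)) + αF * (1 - Dhat d k))
      (f := (atTop : Filter ℕ))).add tendsto_one_div_add_atTop_nhds_zero_nat
    rw [add_zero] at h
    exact tendsto_const_nhds.div h hKpos.ne'
  have hM : Tendsto (fun n : ℕ => (lapAtomsAt d cΦ αΦ (cF - 1 / ((n : ℝ) + 1)) αF RΦ RF k).Mstar) atTop
      (𝓝 (lapAtomsAt d cΦ αΦ cF αF RΦ RF k).Mstar) := by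
    simp only [lapAtomsAt_Mstar_eq]
    exact tendsto_const_nhds.sub (tendsto_const_nhds.mul hC)
  exact ((hC.pow q).mul hM).mul tendsto_const_nhds

/-- **Continuity of the Step-1 slot in the mass at the boundary.**  For `d ≥ 2q + 1`, `c_F + α_F + R̂_F(0) ≤ 1`, `α_F ≥ 1`:
`X_{q,l}(x)` at `c_F − 1/(n+1)` tends to `X_{q,l}(x)` at `c_F` (dominated convergence, majorant `5|D̂|^l|D̂^{(x)}|Ĉ^q`).
[cite: FitznerVanDerHofstad2016NoBLE, §3.3.5 Step 1 (3.59)–(3.60) pp. 1074–1075; HeydenreichVanDerHofstad2017, Prop. 5.5] -/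
theorem tendsto_integral_Cstar_pow_Mstar {q : ℕ} (hd : 2 * q + 1 ≤ d) (hc0 : cF + αF + cosFT RF 0 ≤ 1) (hα : 1 ≤ αF)
    (l : ℕ) (x : Fin d → ℤ) :
    Tendsto (fun n : ℕ => (∫ k, (lapAtomsAt d cΦ αΦ (cF - 1 / ((n : ℝ) + 1)) αF RΦ RF k).Cstar ^ q *
        (lapAtomsAt d cΦ αΦ (cF - 1 / ((n : ℝ) + 1)) αF RΦ RF k).Mstar * (Dhat d k ^ l * DhatSym d x k) ∂P d) / (2 * π) ^ d)
      atTop (𝓝 ((∫ k, (lapAtomsAt d cΦ αΦ cF αF RΦ RF k).Cstar ^ q * (lapAtomsAt d cΦ αΦ cF αF RΦ RF k).Mstar *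
        (Dhat d k ^ l * DhatSym d x k) ∂P d) / (2 * π) ^ d)) := by
  have hd1 : 1 ≤ d := by omega
  refine Tendsto.div_const ?_ _
  refine tendsto_integral_of_dominated_convergence (fun k => 5 * ((|Dhat d k| ^ l * |DhatSym d x k|) * Chat d 1 k ^ q))
    (fun n => (measurable_stepOne_integrand q l x).aestronglyMeasurable)
    ((integrable_srwK_integrand hd l x).const_mul 5) (fun n => ?_) ?_
  · filter_upwards [ae_abs_Dhat_lt_one (d := d) hd1] with k hk
    rw [Real.norm_eq_abs]
    exact abs_stepOne_integrand_le hd1 (perturb_lt_one hc0 n).le hα q l x (abs_lt.1 hk).2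
  · filter_upwards [ae_abs_Dhat_lt_one (d := d) hd1] with k hk
    exact tendsto_stepOne_integrand hc0 hα q l x (abs_lt.1 hk).2

/-- **(S1a) on the closed window** — tail-g9's spec `integral_Cstar_pow_Mstar_le` VERBATIM (`c_F + α_F + R̂_F(0) ≤ 1`):
`∫ Ĉ*^{m+2} M̂* D̂^l D̂^{(x)} dk/(2π)^d ≤ 𝒥_{m+2,l}(x)/α_F^{m+2} + (α_F − 1) I_{m+3,l}(x)/(d α_F^{m+3})`.
[cite: FitznerVanDerHofstad2016NoBLE, §3.3.5 (3.59) p. 1074; Fitzner2013Thesis, §3.6.4 (3.6.55) p. 107] -/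
theorem integral_Cstar_pow_Mstar_le_of_le {m : ℕ} (hd : 2 * (m + 3) + 1 ≤ d)
    (hc0 : cF + αF + cosFT RF 0 ≤ 1) (hα : 1 ≤ αF) (l : ℕ) (x : Fin d → ℤ) :
    (∫ k, (lapAtomsAt d cΦ αΦ cF αF RΦ RF k).Cstar ^ (m + 2) * (lapAtomsAt d cΦ αΦ cF αF RΦ RF k).Mstar *
        (Dhat d k ^ l * DhatSym d x k) ∂P d) / (2 * π) ^ d
      ≤ srwJ d (m + 2) l x / αF ^ (m + 2) + (αF - 1) * srwI d (m + 3) l x / (d * αF ^ (m + 3)) :=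
  le_of_tendsto' (tendsto_integral_Cstar_pow_Mstar (cΦ := cΦ) (αΦ := αΦ) (RΦ := RΦ) (q := m + 2) (by omega) hc0 hα l x)
    fun n => integral_Cstar_pow_Mstar_le hd (perturb_lt_one hc0 n) hα l x

/-- **(S1b) on the closed window** — tail-g9's spec `neg_le_integral_Cstar_pow_Mstar` VERBATIM:
`−(α_F − 1) S_{m+3,l}(x)/(2d² α_F^{m+3}) ≤ ∫ Ĉ*^{m+2} M̂* D̂^l D̂^{(x)} dk/(2π)^d`.
[cite: FitznerVanDerHofstad2016NoBLE, §3.3.5 (3.59) p. 1074; Fitzner2013Thesis, §3.6.4 (3.6.55) p. 107] -/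
theorem neg_le_integral_Cstar_pow_Mstar_of_le {m : ℕ} (hd : 2 * (m + 3) + 1 ≤ d)
    (hc0 : cF + αF + cosFT RF 0 ≤ 1) (hα : 1 ≤ αF) (l : ℕ) (x : Fin d → ℤ) :
    -((αF - 1) * srwIShift2 d (m + 3) l x / (2 * (d : ℝ) ^ 2 * αF ^ (m + 3)))
      ≤ (∫ k, (lapAtomsAt d cΦ αΦ cF αF RΦ RF k).Cstar ^ (m + 2) * (lapAtomsAt d cΦ αΦ cF αF RΦ RF k).Mstar *
          (Dhat d k ^ l * DhatSym d x k) ∂P d) / (2 * π) ^ d :=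
  ge_of_tendsto' (tendsto_integral_Cstar_pow_Mstar (cΦ := cΦ) (αΦ := αΦ) (RΦ := RΦ) (q := m + 2) (by omega) hc0 hα l x)
    fun n => neg_le_integral_Cstar_pow_Mstar hd (perturb_lt_one hc0 n) hα l x

/-- **(S1c) on the closed window** — tail-g9's spec `integral_Cstar_Mstar_le` VERBATIM (`m = −1` slot):
`∫ Ĉ* M̂* D̂^l D̂^{(x)} dk/(2π)^d ≤ I_{1,l+1}(x)/α_F + S_{2,l}(x)/(2d² α_F²)`.
[cite: FitznerVanDerHofstad2016NoBLE, §3.3.5 (3.60) p. 1075; Fitzner2013Thesis, §3.6.4 (3.6.55)–(3.6.56) p. 107] -/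
theorem integral_Cstar_Mstar_le_of_le (hd : 2 * 2 + 1 ≤ d)
    (hc0 : cF + αF + cosFT RF 0 ≤ 1) (hα : 1 ≤ αF) (l : ℕ) (x : Fin d → ℤ) :
    (∫ k, (lapAtomsAt d cΦ αΦ cF αF RΦ RF k).Cstar * (lapAtomsAt d cΦ αΦ cF αF RΦ RF k).Mstar *
        (Dhat d k ^ l * DhatSym d x k) ∂P d) / (2 * π) ^ d
      ≤ srwI d 1 (l + 1) x / αF + srwIShift2 d 2 l x / (2 * (d : ℝ) ^ 2 * αF ^ 2) := by
  have h := tendsto_integral_Cstar_pow_Mstar (cΦ := cΦ) (αΦ := αΦ) (RΦ := RΦ) (q := 1) (by omega) hc0 hα l x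
  simp only [pow_one] at h
  exact le_of_tendsto' h fun n => integral_Cstar_Mstar_le hd (perturb_lt_one hc0 n) hα l x

/-- **(S1d) on the closed window** — tail-g9's spec `neg_le_integral_Cstar_Mstar` VERBATIM (`m = −1` slot):
`−I_{2,l}(x)/(d α_F²) ≤ ∫ Ĉ* M̂* D̂^l D̂^{(x)} dk/(2π)^d`.
[cite: FitznerVanDerHofstad2016NoBLE, §3.3.5 (3.60) p. 1075; Fitzner2013Thesis, §3.6.4 (3.6.55)–(3.6.56) p. 107] -/
theorem neg_le_integral_Cstar_Mstar_of_le (hd : 2 * 2 + 1 ≤ d)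
    (hc0 : cF + αF + cosFT RF 0 ≤ 1) (hα : 1 ≤ αF) (l : ℕ) (x : Fin d → ℤ) :
    -(srwI d 2 l x / (d * αF ^ 2))
      ≤ (∫ k, (lapAtomsAt d cΦ αΦ cF αF RΦ RF k).Cstar * (lapAtomsAt d cΦ αΦ cF αF RΦ RF k).Mstar *
          (Dhat d k ^ l * DhatSym d x k) ∂P d) / (2 * π) ^ d := by
  have h := tendsto_integral_Cstar_pow_Mstar (cΦ := cΦ) (αΦ := αΦ) (RΦ := RΦ) (q := 1) (by omega) hc0 hα l x
  simp only [pow_one] at h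
  exact ge_of_tendsto' h fun n => neg_le_integral_Cstar_Mstar hd (perturb_lt_one hc0 n) hα l x

end Boundary

end Literature.Probability.FitznerVanDerHofstad2017
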